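import Literature.MathematicalPhysics.QuantumFieldTheory.Balaban1983to89.B14FlowStep

/-!
# `Balaban1983to89.B14Sum246Ratio` — T11.F, the coupling-sum step of (2.46) ABSORBS the ratio-form exponent loss
of the per-domain (2.44)-for-𝐑 bound (cell GAPS G-adv3-31): general-exponent layer summability along the flow
(cell `pub-balaban`, unit `b2b-balaban-strat-b14` = strategist of the located step B14 p. 255 / (2.46) p. 263, β
sub-cell CO-LEAD, [III] side; node T11.F; companion of `B14FlowStep` §D / §J / §PowerLaw and of
`B14FlowStepPerturbed` — a separate leaf only because `B14FlowStep.lean` has reached the gate's file-size cap;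
cell GAPS G-adv3-31 / C-adv3-31 (adversarial reader 3, 2026-08-18), MISSING-B14.md v9 §2(q), BETA-SPEC.md §5.12)

HONEST FRAMING (cell rule, page 1 of everything): discharging the β sub-cell's wall makes Bałaban's UV stability
UNCONDITIONAL in the interval-hypothesis sense of [Balaban1989LargeFieldII] p. 355 — a real constructive-QFT result;
it is NOT the continuum limit and NOT the Clay problem.  THIS MODULE DISCHARGES NOTHING: every theorem below is
bookkeeping over real sequences (sums of powers of couplings along a solution of (0.20)).  Nothing about Bałaban's
β-functions (1.22) of [I] and nothing about the terms 𝐑^{(j)} of [III] is asserted; the "ratio-form per-domain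
weight" consumed in §C–§D is the SHAPE of a RECONSTRUCTION by the cell's adversarial reader (GAPS G-adv3-31: the
order count behind p. 283 ll. 18–24), printed nowhere, asserted by nobody.

ABSOLUTE RULE (cell rule, verbatim): "No internally-minted statement may enter as a cited fact. Every hypothesis is
either kernel-proved in this package or a verbatim quotation of a PUBLISHED theorem with page reference. The
manuscript(s) under audit are NOT citable for their own disputed steps — they are the thing under adjudication;
programme-internal (2001/route/tribunal) claims are never citable."

CITATION HEADER (lean-in-tree rule 2026-08-18).  Source under audit: T. Bałaban, *Convergent renormalization
expansions for lattice gauge theories*, Commun. Math. Phys. **119**, 243–285 (1988) [Balaban1988Convergent] (cell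
paper B14 = [III]; journal page = PDF page + 242; renders
`HOME/b2b-balaban-ref1/pages/1988-cmp119-convergent-renormalization/…-p013-x2.png`, `…-p017-x2.png`, `…-p018-x2.png`,
`…-p021-x2.png`, `…-p038-x2.png`, `…-p041-x2.png` READ AS IMAGES for this module by this unit, 2026-08-18); T. Bałaban,
*Renormalization group approach to lattice gauge field theories. I*, Commun. Math. Phys. **109**, 249–301 (1987)
[Balaban1987RG1] (B12 = [I]; (0.20) p. 256 — through `Setup.Flow` and `B14FlowStep`).  What is reproduced: the
sentences of [III] quoted verbatim in the next paragraph (LOCATED, not adjudicated); the displays (2.4), (2.6) p. 255,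
(2.28) p. 259, (2.46) p. 263 enter through `Setup` / `B14` / `B14FlowStep`, whose headers carry them verbatim; each
theorem below carries the cite of the display it concerns, or `[folklore]` when it is pure real arithmetic.

WHAT PRINT SAYS (verbatim, renders as above).  p. 255 [13]: *"ε_j = g_jA₀(log g_j^{−2})^{p₀} = g_jp₀(g_j) ; (2.4)"*.
p. 259 [17]: *"α_{0,j} = g_jC₀(log g_j^{−2})^{q₀} , α_{1,j} = g_jC₁(log g_j^{−2})^{q₁} , (2.28) where q₀, q₁ are
integers greater than 1, C₀, C₁ are sufficiently large positive numbers."*  p. 260 [18], after (2.31)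
*"|𝐑^{(j)}(X,(𝐔,𝐉))| ≤ g_j^{κ₀} exp(−κd_j(X))"*: *"Here κ₀ can be chosen arbitrarily large, similarly as κ, if the
other parameters are fixed properly, as in [I]."* and *"After the vacuum energy renormalization we obtain a sum of
marginal terms, i.e., terms with bounds O(1)(L^jη)⁴g_j^{κ₀}exp(−κd_j(X)). The sum over X is controlled by the
exponential factor, and by the factor (L^jη)⁴. The sum over j is controlled by g_j^{κ₀}."*  p. 263 [21], Theorem 2:
*"Similarly, there exists an absolute constant R₁ such, that |Σ_{X∈𝐃_j, X⊂Λ_j, X∩Ω≠∅} [𝐑^{(j)}(X,U_k) − 𝐑^{(j)}(X,1)]|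
≤ R₁g_j^{κ₀} Σ_{n=j}^{k} |Γ_n∩Ω| , (2.44) for the regular configurations U_k. (In fact the constant R₁ can be taken as
equal to 1 for g_j sufficiently small.)"* and *"Similarly, taking Ω = B^j(Λ_j⁰) in (2.44), and summing over j, we get
|𝐑_k(U_k)| ≤ R₁ Σ_{n=1}^{k} |Γ_n| Σ_{j=1}^{n} g_j^{κ₀} < R₁ Σ_{n=1}^{k} |Γ_n|g_n^{κ₀−6} < Σ_{n=1}^{k} |Γ_n| , (2.46) for
κ₀ ≥ 7 and g sufficiently small."*  p. 280 [38]: *"They have a bit different meaning now, because the configuration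
U_k, or U_{k+1}, restricted to Ω_n∖Ω_{n+1} coincides with a U_n-type confiuration [sic], but the difference is seen in
bounds only."*  p. 283 [41] ll. 18–24: *"The inequality (2.44) for the functions 𝐑^{(j)} can be proved in an almost
identical way. We analyze these functions as above, but we stop at the identity (3.49), where 𝐄^{(2)}(X,x,y,z) is
replaced by 𝐑^{(2)}(X,x,y), and z is an arbitrary point from X. Now all the terms on the right-hand side can be
bounded by O(1)(L^jL^{−n})⁴g_j^{κ₀}exp(−κd_j(X)), and this yields the inequality (2.44)."*

THE LOCATED POINT (GAPS G-adv3-31, adversarial reader 3, LOW; objection-LOCATING, nothing adjudicated here).  The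
order count behind p. 283 ll. 18–24 bounds the m-th 𝐁-derivative of 𝐑^{(j)}(X,·) only through (2.31) and Cauchy's
estimate on the analyticity domain of radius α_{0,j} (2.28), against field factors of n-scale size ε_n (2.4) on
Γ_n ∋ z (p. 280: a U_n-type configuration); the terms therefore carry `g_j^{κ₀}·r^m`, `0 ≤ m ≤ 4`, with the RATIO
`r = ε_n/α_{0,j} = (A₀/C₀)(g_n/g_j)(log g_n^{−2})^{p₀}(log g_j^{−2})^{−q₀}`, and along the flow `g_n/g_j` is
UNBOUNDED in the lag `n − j` (§E below: `(g_n/g_j)² ≥ 1 + b·g_n²·(n−j)`) — so the per-domain bound holds with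
`g_j^{κ₀−4}`, not with the printed `g_j^{κ₀}`, and the reader books the chain (2.31) ⇒ (2.44) ⇒ (2.46) as needing
`κ₀ ≥ 11` in place of the printed `κ₀ ≥ 7` (harmless for the end statement: p. 260 *"κ₀ can be chosen arbitrarily
large"*).  WHAT THIS MODULE ADDS (consumer side = this unit's located coupling-sum step): booked in its RATIO form
`g_j^{κ₀}·(1 + Λ(g_n/g_j)⁴)` — which is what the Cauchy count gives before `g_n ≤ γ` is spent — the loss is absorbed
by the sum over `j` in (2.46): along any solution of (0.20) with `β ≥ b > 0`,
`Σ_{j=1}^{n} g_j^{κ₀−m} g_n^m ≤ 2g_n^{κ₀−2}/((κ₀−m−2)b) + g_n^{κ₀}` for every `m ≤ κ₀ − 3` (§C), the SAME shape as the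
unshifted sum; hence the middle AND last members of (2.46) hold AS PRINTED — threshold `κ₀ ≥ 7` AS PRINTED, constant
`R₁` unchanged — at the sole cost of the pure γ-smallness `(1+Λ)(2γ⁴/((κ₀−6)b) + γ⁶) < 1` (§D).  The engine (§A–§B)
is the integral test `Σ_{j<n} g_j^κ ≤ 2g_n^{κ−2}/((κ−2)b)` for EVERY natural `κ ≥ 3` (Bernoulli telescoping of
`(1/g_j² )^{1−κ/2}`; `Step.sum_sixth_powers_le` is `κ = 6`, `B14FlowStep.powSum_le_of_betaPowerLower` the even `κ`),
also from the DEFECTED running of averaged / eventual asymptotic freedom (the cell's END-statement grade,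
`B14FlowStep` §J), with `√2·g_n` in place of `g_n`.  §E records the obstruction in the kernel: the flow gives the
OPPOSITE of the lag-uniform ratio bound a same-`κ₀` per-domain estimate would need.  §F types the B14 instance of the
ratio: `ε_n/α_{0,j} ≤ (A₀/C₀)(g_n/g_j)` for `g_j ≤ g_n`, `log g_n^{−2} ≥ 1`, under `q₀ ≥ p₀` — the cell's
RECONSTRUCTED exponent condition (X12) of `SMALLNESS.md` §4.1 (`B14Radii.fits_of_exponents` / `exponent_necessary`;
(2.28) prints only *"q₀, q₁ are integers greater than 1"*), NOT printed.
CENSUS CONSEQUENCE (cell MISSING-B14 v9 §2(q)): G-adv3-31 changes NOTHING in the located step's residual — (2.46) is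
consumed from the flow exactly as before (positive lower bound `b` / averaged AF with defect), with the printed
`κ₀ ≥ 7`; the exponent shift lives entirely on the B14 §3 side (Cauchy count, `B14Thm2.Rep244`), which is not this
module's object and about which nothing is asserted here.
-/

namespace Literature.MathematicalPhysics.QuantumFieldTheory.Balaban1983to89.B14Sum246Ratio

open Literature.MathematicalPhysics.QuantumFieldTheory.Balaban1983to89
open Finset

/-! ## A. The integral test by Bernoulli telescoping (real exponent) -/

/-- Bernoulli's inequality for a NEGATIVE exponent: `1 + a·t ≤ (1 − t)^{−a}` for `t < 1`, `a ≥ 0`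
(`(1−t)^{−a} = exp(−a·log(1−t)) ≥ exp(a·t) ≥ 1 + a·t`). [folklore] -/
theorem one_add_mul_le_one_sub_rpow_neg {t a : ℝ} (ht1 : t < 1) (ha : 0 ≤ a) :
    1 + a * t ≤ (1 - t) ^ (-a) := by
  have h1t : 0 < 1 - t := by linarith
  rw [Real.rpow_def_of_pos h1t]
  have hlog : Real.log (1 - t) ≤ -t := by
    have := Real.log_le_sub_one_of_pos h1t; linarith
  have harg : a * t ≤ Real.log (1 - t) * (-a) := by nlinarith
  calc 1 + a * t = a * t + 1 := by ring
    _ ≤ Real.exp (a * t) := Real.add_one_le_exp _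
    _ ≤ Real.exp (Real.log (1 - t) * (-a)) := Real.exp_le_exp.mpr harg

/-- One telescoping step of the integral test: for `w > 0`, `b > 0`, `a ≥ 0`,
`a·b·(w+b)^{−(a+1)} ≤ w^{−a} − (w+b)^{−a}` (convexity of `x ↦ x^{−a}`, in Bernoulli form). [folklore] -/
theorem rpow_telescope_step {w b a : ℝ} (hw : 0 < w) (hb : 0 < b) (ha : 0 ≤ a) :
    a * b * (w + b) ^ (-(a + 1)) ≤ w ^ (-a) - (w + b) ^ (-a) := by
  set u := w + b with hu
  have hu0 : 0 < u := by rw [hu]; linarith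
  set t := b / u with ht
  have ht1 : t < 1 := by rw [ht, div_lt_one hu0, hu]; linarith
  have hut : u * t = b := by rw [ht, ← mul_div_assoc, mul_div_cancel_left₀ b hu0.ne']
  have hwu : w = u * (1 - t) := by
    have : u * (1 - t) = u - u * t := by ring
    rw [this, hut, hu]; ring
  have hB := one_add_mul_le_one_sub_rpow_neg ht1 ha
  -- w^{-a} = u^{-a} (1-t)^{-a}
  have hsplit : w ^ (-a) = u ^ (-a) * (1 - t) ^ (-a) := by
    rw [hwu, Real.mul_rpow hu0.le (by linarith)]
  have hua : 0 < u ^ (-a) := Real.rpow_pos_of_pos hu0 _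
  -- u^{-(a+1)} = u^{-a} / u
  have hsucc : u ^ (-(a + 1)) = u ^ (-a) * u⁻¹ := by
    rw [show -(a + 1) = -a + (-1) by ring, Real.rpow_add hu0, Real.rpow_neg_one]
  rw [hsplit, hsucc]
  have key : u ^ (-a) * (1 + a * t) ≤ u ^ (-a) * (1 - t) ^ (-a) := mul_le_mul_of_nonneg_left hB hua.le
  have e : u ^ (-a) * (1 + a * t) = u ^ (-a) + a * b * (u ^ (-a) * u⁻¹) := by
    have hbu : b * u⁻¹ = t := by rw [ht, div_eq_mul_inv]
    calc u ^ (-a) * (1 + a * t) = u ^ (-a) + a * t * u ^ (-a) := by ring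
      _ = u ^ (-a) + a * (b * u⁻¹) * u ^ (-a) := by rw [hbu]
      _ = u ^ (-a) + a * b * (u ^ (-a) * u⁻¹) := by ring
  linarith [key, e]

/-- The integral test, summed: `Σ_{i<N} (y + b(i+1))^{−(a+1)} ≤ y^{−a}/(a·b)` for `y, b, a > 0`. [folklore] -/
theorem sum_rpow_shift_le {y b a : ℝ} (hy : 0 < y) (hb : 0 < b) (ha : 0 < a) (N : ℕ) :
    ∑ i ∈ Finset.range N, (y + b * ((i : ℝ) + 1)) ^ (-(a + 1)) ≤ y ^ (-a) / (a * b) := by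
  set f : ℕ → ℝ := fun i => (y + b * (i : ℝ)) ^ (-a) with hf
  have hab : 0 < a * b := mul_pos ha hb
  have hstep : ∀ i ∈ Finset.range N,
      (y + b * ((i : ℝ) + 1)) ^ (-(a + 1)) ≤ (1 / (a * b)) * (f i - f (i + 1)) := by
    intro i _
    have hw : 0 < y + b * (i : ℝ) := by positivity
    have h := rpow_telescope_step hw hb ha.le
    have e1 : y + b * ((i : ℝ) + 1) = (y + b * (i : ℝ)) + b := by ring
    have e2 : f (i + 1) = ((y + b * (i : ℝ)) + b) ^ (-a) := by
      show (y + b * ((i + 1 : ℕ) : ℝ)) ^ (-a) = _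
      congr 1; push_cast; ring
    have e3 : f i = (y + b * (i : ℝ)) ^ (-a) := rfl
    rw [e1, e2, e3]
    rw [show (1 / (a * b)) * ((y + b * (i : ℝ)) ^ (-a) - ((y + b * (i : ℝ)) + b) ^ (-a)) =
        ((y + b * (i : ℝ)) ^ (-a) - ((y + b * (i : ℝ)) + b) ^ (-a)) / (a * b) by ring]
    rw [le_div_iff₀ hab]
    linarith
  calc ∑ i ∈ Finset.range N, (y + b * ((i : ℝ) + 1)) ^ (-(a + 1))
      ≤ ∑ i ∈ Finset.range N, (1 / (a * b)) * (f i - f (i + 1)) := Finset.sum_le_sum hstep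
    _ = (1 / (a * b)) * (f 0 - f N) := by rw [← Finset.mul_sum, Finset.sum_range_sub']
    _ ≤ (1 / (a * b)) * f 0 := by
        have h0 : 0 ≤ f N := by simp only [hf]; exact Real.rpow_nonneg (by positivity) _
        have h1 : 0 ≤ 1 / (a * b) := by positivity
        nlinarith
    _ = y ^ (-a) / (a * b) := by simp only [hf, Nat.cast_zero, mul_zero, add_zero]; ring

/-- **Engine** (the real-exponent analogue of `Step.sum_sixth_powers_le`): if `1/g_j² ≥ y + b·(n − j)` for `j < n`
(`y, b > 0`) — what (0.20) with `β ≥ b` gives with `y = 1/g_n²`, and what the DEFECTED running of averaged asymptotic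
freedom gives with `y = 1/g_n² − B` — then `Σ_{j<n} (g_j²)^{a+1} ≤ y^{−a}/(a·b)` for every real `a > 0`. [folklore] -/
theorem sum_rpow_le_of_running {n : ℕ} {g : ℕ → ℝ} {y b a : ℝ} (hy : 0 < y) (hb : 0 < b) (ha : 0 < a)
    (hpos : ∀ j, j < n → 0 < g j)
    (hrun : ∀ j, j < n → y + b * ((n : ℝ) - j) ≤ 1 / (g j) ^ 2) :
    ∑ j ∈ Finset.range n, ((g j) ^ 2) ^ (a + 1) ≤ y ^ (-a) / (a * b) := by
  have hterm : ∀ j ∈ Finset.range n, ((g j) ^ 2) ^ (a + 1) ≤ (y + b * ((n : ℝ) - j)) ^ (-(a + 1)) := by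
    intro j hj
    have hjn : j < n := Finset.mem_range.mp hj
    have hgj : 0 < g j := hpos j hjn
    have hq : 0 < y + b * ((n : ℝ) - j) := by
      have : (j : ℝ) < n := by exact_mod_cast hjn
      nlinarith
    have h2 : (g j) ^ 2 ≤ (y + b * ((n : ℝ) - j))⁻¹ := by
      rw [le_inv_comm₀ (by positivity) hq]
      have := hrun j hjn
      rwa [one_div] at this
    calc ((g j) ^ 2) ^ (a + 1) ≤ ((y + b * ((n : ℝ) - j))⁻¹) ^ (a + 1) :=
          Real.rpow_le_rpow (by positivity) h2 (by linarith)
      _ = (y + b * ((n : ℝ) - j)) ^ (-(a + 1)) := by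
          rw [Real.inv_rpow hq.le, Real.rpow_neg hq.le]
  have hreindex : ∑ j ∈ Finset.range n, (y + b * ((n : ℝ) - j)) ^ (-(a + 1))
      = ∑ i ∈ Finset.range n, (y + b * ((i : ℝ) + 1)) ^ (-(a + 1)) := by
    rw [← Finset.sum_range_reflect]
    apply Finset.sum_congr rfl
    intro i hi
    have hin : i < n := Finset.mem_range.mp hi
    have : ((n - 1 - i : ℕ) : ℝ) = (n : ℝ) - 1 - i := by
      rw [Nat.cast_sub (by omega), Nat.cast_sub (by omega)]; push_cast; ring
    rw [this]
    ring_nf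
  calc ∑ j ∈ Finset.range n, ((g j) ^ 2) ^ (a + 1)
      ≤ ∑ j ∈ Finset.range n, (y + b * ((n : ℝ) - j)) ^ (-(a + 1)) := Finset.sum_le_sum hterm
    _ = ∑ i ∈ Finset.range n, (y + b * ((i : ℝ) + 1)) ^ (-(a + 1)) := hreindex
    _ ≤ y ^ (-a) / (a * b) := sum_rpow_shift_le hy hb ha n

/-- `g^κ = (g²)^{κ/2}` as a real power, `g ≥ 0`. [folklore] -/
theorem pow_eq_sq_rpow {g : ℝ} (hg : 0 ≤ g) (κ : ℕ) :
    (g ^ κ : ℝ) = ((g ^ 2) ^ ((κ : ℝ) / 2) : ℝ) := by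
  rw [← Real.rpow_natCast g 2, ← Real.rpow_mul hg, ← Real.rpow_natCast g κ]
  congr 1; push_cast; ring

/-- **Engine, natural powers**: under the running hypothesis of `sum_rpow_le_of_running` and `1/y ≤ G²` (`G ≥ 0`),
`Σ_{j<n} g_j^κ ≤ (2/((κ−2)b))·G^{κ−2}` for every natural `κ ≥ 3` (`a = κ/2 − 1`).  With `y = 1/g_n²`, `G = g_n` this is
`Σ_{j<n} g_j^κ ≤ 2g_n^{κ−2}/((κ−2)b)`; `κ = 6` is `Step.sum_sixth_powers_le`'s `g_n⁴/(2b)`. [folklore] -/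
theorem sum_pow_le_of_running {n : ℕ} {g : ℕ → ℝ} {y b : ℝ} (hy : 0 < y) (hb : 0 < b)
    {κ : ℕ} (hκ : 3 ≤ κ)
    (hpos : ∀ j, j < n → 0 < g j)
    (hrun : ∀ j, j < n → y + b * ((n : ℝ) - j) ≤ 1 / (g j) ^ 2)
    {G : ℝ} (hG : 0 ≤ G) (hyG : 1 / y ≤ G ^ 2) :
    ∑ j ∈ Finset.range n, (g j) ^ κ ≤ 2 / (((κ : ℝ) - 2) * b) * G ^ (κ - 2) := by
  set a : ℝ := ((κ : ℝ) - 2) / 2 with ha_def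
  have hκR : (3 : ℝ) ≤ κ := by exact_mod_cast hκ
  have ha : 0 < a := by rw [ha_def]; linarith
  have hmain := sum_rpow_le_of_running hy hb ha hpos hrun
  -- rewrite the summands
  have hsum : ∑ j ∈ Finset.range n, (g j) ^ κ = ∑ j ∈ Finset.range n, ((g j) ^ 2) ^ (a + 1) := by
    apply Finset.sum_congr rfl
    intro j hj
    have hgj : 0 ≤ g j := (hpos j (Finset.mem_range.mp hj)).le
    rw [pow_eq_sq_rpow hgj κ]
    congr 1; rw [ha_def]; ring
  -- rewrite the bound
  have hya : y ^ (-a) = (1 / y) ^ a := by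
    rw [Real.rpow_neg hy.le, one_div, Real.inv_rpow hy.le]
  have hmono : (1 / y) ^ a ≤ (G ^ 2) ^ a := Real.rpow_le_rpow (by positivity) hyG ha.le
  have hGpow : (G ^ 2) ^ a = G ^ (κ - 2) := by
    rw [← Real.rpow_natCast G 2, ← Real.rpow_mul hG, ← Real.rpow_natCast G (κ - 2)]
    congr 1
    rw [Nat.cast_sub (by omega : 2 ≤ κ), ha_def]; push_cast; ring
  have hab : a * b = ((κ : ℝ) - 2) * b / 2 := by rw [ha_def]; ring
  have hκb : 0 < ((κ : ℝ) - 2) * b := mul_pos (by linarith) hb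
  rw [hsum]
  calc ∑ j ∈ Finset.range n, ((g j) ^ 2) ^ (a + 1) ≤ y ^ (-a) / (a * b) := hmain
    _ = (1 / y) ^ a / (a * b) := by rw [hya]
    _ ≤ (G ^ 2) ^ a / (a * b) := div_le_div_of_nonneg_right hmono (mul_pos ha hb).le
    _ = 2 / (((κ : ℝ) - 2) * b) * G ^ (κ - 2) := by rw [hGpow, hab]; field_simp

/-! ## B. Layer summability for EVERY natural exponent `κ ≥ 3` along the flow -/

section AlongFlow
variable (F : Flow) (K : ℕ)

/-- **General-exponent layer summability from a POSITIVE lower bound `b` along the flow**: (0.20), positive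
couplings and `b ≤ β_{j+1}(g_j)` (`b > 0`) for `j < K` give, for every natural `κ ≥ 3` and every `n ≤ K`,
`Σ_{j=1}^{n} g_j^κ ≤ 2g_n^{κ−2}/((κ−2)b) + g_n^κ` — uniformly in `n` and `K`.  (`κ = 6`: `B14FlowStep.sum246_sharp`'s
`g_n⁴/(2b) + g_n⁶`; even `κ`: `B14FlowStep.layerSum_le_of_betaPowerLower` with `M = 0`; odd `κ` is new.) [cite: Balaban1988Convergent, (2.46) p.263 and p.260 (after (2.31))] -/
theorem layerSum_le_of_betaLower {b : ℝ} (hb : 0 < b)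
    (hpos : ∀ j, j ≤ K → 0 < F.g j) (hrg : F.SatisfiesRG K)
    (hlb : ∀ j, j < K → b ≤ F.β (j + 1) (F.g j))
    {κ : ℕ} (hκ : 3 ≤ κ) {n : ℕ} (hnK : n ≤ K) :
    ∑ j ∈ Finset.Icc 1 n, (F.g j) ^ κ ≤ 2 / (((κ : ℝ) - 2) * b) * (F.g n) ^ (κ - 2) + (F.g n) ^ κ := by
  have hn : 0 < F.g n := hpos n hnK
  have hrun : ∀ j, j < n → 1 / (F.g n) ^ 2 + b * ((n : ℝ) - j) ≤ 1 / (F.g j) ^ 2 :=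
    fun j hj => B14FlowStep.running_of_betaLower F K hrg hlb hj.le hnK
  have h1 : ∑ j ∈ Finset.range n, (F.g j) ^ κ ≤ 2 / (((κ : ℝ) - 2) * b) * (F.g n) ^ (κ - 2) :=
    sum_pow_le_of_running (by positivity) hb hκ (fun j hj => hpos j (hj.le.trans hnK)) hrun hn.le
      (by rw [one_div_one_div])
  have h2 : ∑ j ∈ Finset.Icc 1 n, (F.g j) ^ κ ≤ ∑ j ∈ Finset.range (n + 1), (F.g j) ^ κ := by
    apply Finset.sum_le_sum_of_subset_of_nonneg
    · intro j hj
      rw [Finset.mem_range]; exact Nat.lt_succ_of_le (Finset.mem_Icc.mp hj).2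
    · intro j hj _
      exact pow_nonneg (hpos j ((Nat.le_of_lt_succ (Finset.mem_range.mp hj)).trans hnK)).le _
  calc ∑ j ∈ Finset.Icc 1 n, (F.g j) ^ κ ≤ ∑ j ∈ Finset.range (n + 1), (F.g j) ^ κ := h2
    _ = ∑ j ∈ Finset.range n, (F.g j) ^ κ + (F.g n) ^ κ := Finset.sum_range_succ _ _
    _ ≤ 2 / (((κ : ℝ) - 2) * b) * (F.g n) ^ (κ - 2) + (F.g n) ^ κ := by linarith

/-- **General-exponent layer summability from the DEFECTED running** (averaged / eventual asymptotic freedom — the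
cell's END-statement grade, `B14FlowStep` §J): (0.20), the interval hypothesis `0 < g_k ≤ γ`,
`b(n−m) − B ≤ Σ_{j∈[m,n)} β_{j+1}(g_j)` for all `m ≤ n ≤ K` (`b > 0`) and `Bγ² ≤ 1/2` give, for every natural `κ ≥ 3`
and `n ≤ K`, `Σ_{j=1}^{n} g_j^κ ≤ (2/((κ−2)b))·(√2·g_n)^{κ−2} + g_n^κ` (the defect is absorbed into `y = 1/(2g_n²)`,
as in `B14FlowStep.sumIneq246_of_avgAF`). [cite: Balaban1988Convergent, (2.46) p.263] -/
theorem layerSum_le_of_avgAF {b B γ : ℝ} (hb : 0 < b) (hrg : F.SatisfiesRG K) (hI : F.InInterval γ K)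
    (hav : ∀ m n, m ≤ n → n ≤ K → b * ((n : ℝ) - m) - B ≤ ∑ j ∈ Finset.Ico m n, F.β (j + 1) (F.g j))
    (hBγ : B * γ ^ 2 ≤ 1 / 2) {κ : ℕ} (hκ : 3 ≤ κ) {n : ℕ} (hnK : n ≤ K) :
    ∑ j ∈ Finset.Icc 1 n, (F.g j) ^ κ ≤
      2 / (((κ : ℝ) - 2) * b) * (Real.sqrt 2 * F.g n) ^ (κ - 2) + (F.g n) ^ κ := by
  have hpos : ∀ j, j ≤ K → 0 < F.g j := fun j hj => (hI j hj).1
  have hn : 0 < F.g n := hpos n hnK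
  have hnγ : F.g n ≤ γ := (hI n hnK).2
  have hγ : 0 < γ := lt_of_lt_of_le hn hnγ
  have hBn : B ≤ 1 / (2 * (F.g n) ^ 2) := by
    have hg2 : (F.g n) ^ 2 ≤ γ ^ 2 := pow_le_pow_left₀ hn.le hnγ 2
    have h1 : B ≤ 1 / (2 * γ ^ 2) := by
      rw [le_div_iff₀ (by positivity)]; linarith
    have h2 : 1 / (2 * γ ^ 2) ≤ 1 / (2 * (F.g n) ^ 2) :=
      one_div_le_one_div_of_le (by positivity) (by linarith)
    exact h1.trans h2
  set y := 1 / (2 * (F.g n) ^ 2) with hy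
  have hy0 : 0 < y := by rw [hy]; positivity
  have hrun : ∀ j, j < n → y + b * ((n : ℝ) - j) ≤ 1 / (F.g j) ^ 2 := by
    intro j hj
    have := B14FlowStep.running_of_avgAF F K hrg hav hj.le hnK
    have e : 1 / (F.g n) ^ 2 = 2 * y := by rw [hy]; field_simp
    linarith
  have hyG : 1 / y ≤ (Real.sqrt 2 * F.g n) ^ 2 := by
    rw [hy, one_div_one_div, mul_pow, Real.sq_sqrt (by norm_num : (0:ℝ) ≤ 2)]
  have h1 : ∑ j ∈ Finset.range n, (F.g j) ^ κ ≤
      2 / (((κ : ℝ) - 2) * b) * (Real.sqrt 2 * F.g n) ^ (κ - 2) :=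
    sum_pow_le_of_running hy0 hb hκ (fun j hj => hpos j (hj.le.trans hnK)) hrun (by positivity) hyG
  have h2 : ∑ j ∈ Finset.Icc 1 n, (F.g j) ^ κ ≤ ∑ j ∈ Finset.range (n + 1), (F.g j) ^ κ := by
    apply Finset.sum_le_sum_of_subset_of_nonneg
    · intro j hj
      rw [Finset.mem_range]; exact Nat.lt_succ_of_le (Finset.mem_Icc.mp hj).2
    · intro j hj _
      exact pow_nonneg (hpos j ((Nat.le_of_lt_succ (Finset.mem_range.mp hj)).trans hnK)).le _
  calc ∑ j ∈ Finset.Icc 1 n, (F.g j) ^ κ ≤ ∑ j ∈ Finset.range (n + 1), (F.g j) ^ κ := h2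
    _ = ∑ j ∈ Finset.range n, (F.g j) ^ κ + (F.g n) ^ κ := Finset.sum_range_succ _ _
    _ ≤ 2 / (((κ : ℝ) - 2) * b) * (Real.sqrt 2 * F.g n) ^ (κ - 2) + (F.g n) ^ κ := by linarith

/-! ## C. The RATIO-SHIFTED layer sums `Σ_{j≤n} g_j^{κ₀−m} g_n^m` -/

/-- The ratio reading of the shifted summand: `g_j^{κ₀}·(g_n/g_j)^m = g_j^{κ₀−m}·g_n^m` (`g_j ≠ 0`, `m ≤ κ₀`). [folklore] -/
theorem ratio_term_eq {gj gn : ℝ} (hgj : gj ≠ 0) {κ₀ m : ℕ} (hm : m ≤ κ₀) :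
    gj ^ κ₀ * (gn / gj) ^ m = gj ^ (κ₀ - m) * gn ^ m := by
  rw [div_pow]
  have e : gj ^ κ₀ = gj ^ (κ₀ - m) * gj ^ m := by rw [← pow_add]; congr 1; omega
  rw [e]; field_simp

/-- **The ratio-shifted sum along a b-flow**: (0.20), positive couplings, `b ≤ β_{j+1}(g_j)` (`b > 0`) give, for every
`m + 3 ≤ κ₀` and `n ≤ K`, `Σ_{j=1}^{n} g_j^{κ₀−m}·g_n^m ≤ 2g_n^{κ₀−2}/((κ₀−m−2)b) + g_n^{κ₀}` — the SAME shape as the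
unshifted layer sum (`m = 0`): the factor `(g_n/g_j)^m`, unbounded term by term (§E), costs only the constant
`κ₀−2 ↦ κ₀−m−2`. [cite: Balaban1988Convergent, (2.46) p.263] -/
theorem ratioSum_le_of_betaLower {b : ℝ} (hb : 0 < b)
    (hpos : ∀ j, j ≤ K → 0 < F.g j) (hrg : F.SatisfiesRG K)
    (hlb : ∀ j, j < K → b ≤ F.β (j + 1) (F.g j))
    {κ₀ m : ℕ} (hm : m + 3 ≤ κ₀) {n : ℕ} (hnK : n ≤ K) :
    ∑ j ∈ Finset.Icc 1 n, (F.g j) ^ (κ₀ - m) * (F.g n) ^ m ≤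
      2 / (((κ₀ : ℝ) - m - 2) * b) * (F.g n) ^ (κ₀ - 2) + (F.g n) ^ κ₀ := by
  have hn : 0 < F.g n := hpos n hnK
  have hκ : 3 ≤ κ₀ - m := by omega
  have h := layerSum_le_of_betaLower F K hb hpos hrg hlb hκ hnK
  have hcast : ((κ₀ - m : ℕ) : ℝ) - 2 = (κ₀ : ℝ) - m - 2 := by
    rw [Nat.cast_sub (by omega)]
  rw [← Finset.sum_mul]
  have hm0 : 0 ≤ (F.g n) ^ m := pow_nonneg hn.le m
  calc (∑ j ∈ Finset.Icc 1 n, (F.g j) ^ (κ₀ - m)) * (F.g n) ^ m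
      ≤ (2 / ((((κ₀ - m : ℕ) : ℝ) - 2) * b) * (F.g n) ^ (κ₀ - m - 2) + (F.g n) ^ (κ₀ - m)) * (F.g n) ^ m :=
        mul_le_mul_of_nonneg_right h hm0
    _ = 2 / (((κ₀ : ℝ) - m - 2) * b) * (F.g n) ^ (κ₀ - 2) + (F.g n) ^ κ₀ := by
        rw [hcast, add_mul, mul_assoc, ← pow_add, ← pow_add,
          show κ₀ - m - 2 + m = κ₀ - 2 by omega, show κ₀ - m + m = κ₀ by omega]

/-- The same in the `(2.46)` currency `(…)·g_n^{κ₀−6}` (`κ₀ ≥ 6`):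
`Σ_{j=1}^{n} g_j^{κ₀−m}·g_n^m ≤ (2g_n⁴/((κ₀−m−2)b) + g_n⁶)·g_n^{κ₀−6}`. [cite: Balaban1988Convergent, (2.46) p.263] -/
theorem ratioSum_le_of_betaLower' {b : ℝ} (hb : 0 < b)
    (hpos : ∀ j, j ≤ K → 0 < F.g j) (hrg : F.SatisfiesRG K)
    (hlb : ∀ j, j < K → b ≤ F.β (j + 1) (F.g j))
    {κ₀ m : ℕ} (hm : m + 3 ≤ κ₀) (h6 : 6 ≤ κ₀) {n : ℕ} (hnK : n ≤ K) :
    ∑ j ∈ Finset.Icc 1 n, (F.g j) ^ (κ₀ - m) * (F.g n) ^ m ≤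
      (2 * (F.g n) ^ 4 / (((κ₀ : ℝ) - m - 2) * b) + (F.g n) ^ 6) * (F.g n) ^ (κ₀ - 6) := by
  have h := ratioSum_le_of_betaLower F K hb hpos hrg hlb hm hnK
  have h4 : (F.g n) ^ (κ₀ - 2) = (F.g n) ^ 4 * (F.g n) ^ (κ₀ - 6) := by
    rw [← pow_add]; congr 1; omega
  have h6' : (F.g n) ^ κ₀ = (F.g n) ^ 6 * (F.g n) ^ (κ₀ - 6) := by
    rw [← pow_add]; congr 1; omega
  have e : 2 / (((κ₀ : ℝ) - m - 2) * b) * (F.g n) ^ (κ₀ - 2) + (F.g n) ^ κ₀ =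
      (2 * (F.g n) ^ 4 / (((κ₀ : ℝ) - m - 2) * b) + (F.g n) ^ 6) * (F.g n) ^ (κ₀ - 6) := by
    rw [h4, h6']; ring
  rw [← e]; exact h

/-- **The ratio-shifted sum from the DEFECTED running** (averaged / eventual AF, END-statement grade): as
`ratioSum_le_of_betaLower'` with `(√2)^{κ₀−2}` in the constant. [cite: Balaban1988Convergent, (2.46) p.263] -/
theorem ratioSum_le_of_avgAF {b B γ : ℝ} (hb : 0 < b) (hrg : F.SatisfiesRG K) (hI : F.InInterval γ K)
    (hav : ∀ m n, m ≤ n → n ≤ K → b * ((n : ℝ) - m) - B ≤ ∑ j ∈ Finset.Ico m n, F.β (j + 1) (F.g j))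
    (hBγ : B * γ ^ 2 ≤ 1 / 2) {κ₀ m : ℕ} (hm : m + 3 ≤ κ₀) (h6 : 6 ≤ κ₀) {n : ℕ} (hnK : n ≤ K) :
    ∑ j ∈ Finset.Icc 1 n, (F.g j) ^ (κ₀ - m) * (F.g n) ^ m ≤
      Real.sqrt 2 ^ (κ₀ - 2) *
        ((2 * (F.g n) ^ 4 / (((κ₀ : ℝ) - m - 2) * b) + (F.g n) ^ 6) * (F.g n) ^ (κ₀ - 6)) := by
  have hpos : ∀ j, j ≤ K → 0 < F.g j := fun j hj => (hI j hj).1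
  have hn : 0 < F.g n := hpos n hnK
  have hκ : 3 ≤ κ₀ - m := by omega
  have h := layerSum_le_of_avgAF F K hb hrg hI hav hBγ hκ hnK
  have hcast : ((κ₀ - m : ℕ) : ℝ) - 2 = (κ₀ : ℝ) - m - 2 := by
    rw [Nat.cast_sub (by omega)]
  rw [hcast, show κ₀ - m - 2 = κ₀ - 2 - m by omega] at h
  have hs1 : 1 ≤ Real.sqrt 2 := by
    rw [show (1:ℝ) = Real.sqrt 1 by simp]; exact Real.sqrt_le_sqrt (by norm_num)
  have hs0 : 0 ≤ Real.sqrt 2 := Real.sqrt_nonneg 2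
  have hc : 0 < ((κ₀ : ℝ) - m - 2) * b := by
    have : (3 : ℝ) ≤ (κ₀ : ℝ) - m := by
      have : ((m + 3 : ℕ) : ℝ) ≤ κ₀ := by exact_mod_cast hm
      push_cast at this; linarith
    exact mul_pos (by linarith) hb
  -- (√2 g_n)^{κ₀-2-m} g_n^m ≤ (√2)^{κ₀-2} g_n^{κ₀-2}
  have hA : (Real.sqrt 2 * F.g n) ^ (κ₀ - 2 - m) * (F.g n) ^ m ≤ Real.sqrt 2 ^ (κ₀ - 2) * (F.g n) ^ (κ₀ - 2) := by
    rw [mul_pow, mul_assoc, ← pow_add, show κ₀ - 2 - m + m = κ₀ - 2 by omega]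
    exact mul_le_mul_of_nonneg_right (pow_le_pow_right₀ hs1 (by omega)) (by positivity)
  have hB : (F.g n) ^ (κ₀ - m) * (F.g n) ^ m ≤ Real.sqrt 2 ^ (κ₀ - 2) * (F.g n) ^ κ₀ := by
    rw [← pow_add, show κ₀ - m + m = κ₀ by omega]
    exact le_mul_of_one_le_left (by positivity) (one_le_pow₀ hs1)
  rw [← Finset.sum_mul]
  have h4 : (F.g n) ^ (κ₀ - 2) = (F.g n) ^ 4 * (F.g n) ^ (κ₀ - 6) := by
    rw [← pow_add]; congr 1; omega
  have h6' : (F.g n) ^ κ₀ = (F.g n) ^ 6 * (F.g n) ^ (κ₀ - 6) := by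
    rw [← pow_add]; congr 1; omega
  have e : Real.sqrt 2 ^ (κ₀ - 2) *
        ((2 * (F.g n) ^ 4 / (((κ₀ : ℝ) - m - 2) * b) + (F.g n) ^ 6) * (F.g n) ^ (κ₀ - 6)) =
      2 / (((κ₀ : ℝ) - m - 2) * b) * (Real.sqrt 2 ^ (κ₀ - 2) * (F.g n) ^ (κ₀ - 2)) +
        Real.sqrt 2 ^ (κ₀ - 2) * (F.g n) ^ κ₀ := by
    rw [h4, h6']; ring
  rw [e]
  have hc' : 0 ≤ 2 / (((κ₀ : ℝ) - m - 2) * b) := by positivity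
  calc (∑ j ∈ Finset.Icc 1 n, (F.g j) ^ (κ₀ - m)) * (F.g n) ^ m
      ≤ (2 / (((κ₀ : ℝ) - m - 2) * b) * (Real.sqrt 2 * F.g n) ^ (κ₀ - 2 - m) + (F.g n) ^ (κ₀ - m))
          * (F.g n) ^ m := mul_le_mul_of_nonneg_right h (pow_nonneg hn.le m)
    _ = 2 / (((κ₀ : ℝ) - m - 2) * b) * ((Real.sqrt 2 * F.g n) ^ (κ₀ - 2 - m) * (F.g n) ^ m)
          + (F.g n) ^ (κ₀ - m) * (F.g n) ^ m := by ring
    _ ≤ 2 / (((κ₀ : ℝ) - m - 2) * b) * (Real.sqrt 2 ^ (κ₀ - 2) * (F.g n) ^ (κ₀ - 2))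
          + Real.sqrt 2 ^ (κ₀ - 2) * (F.g n) ^ κ₀ := by
        have := mul_le_mul_of_nonneg_left hA hc'
        linarith

/-! ## D. (2.46) AS PRINTED (`κ₀ ≥ 7`) from a RATIO-FORM per-pair weight -/

/-- The (2.46) currency is monotone in the coupling: `0 ≤ x ≤ γ` gives `2x⁴/c + x⁶ ≤ 2γ⁴/c + γ⁶` (`c > 0`). [folklore] -/
theorem currency_mono {x γ c : ℝ} (hx : 0 ≤ x) (hxγ : x ≤ γ) (hc : 0 < c) :
    2 * x ^ 4 / c + x ^ 6 ≤ 2 * γ ^ 4 / c + γ ^ 6 := by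
  have h4 : x ^ 4 ≤ γ ^ 4 := pow_le_pow_left₀ hx hxγ 4
  have h6 : x ^ 6 ≤ γ ^ 6 := pow_le_pow_left₀ hx hxγ 6
  have : 2 * x ^ 4 / c ≤ 2 * γ ^ 4 / c := div_le_div_of_nonneg_right (by linarith) hc.le
  linarith

/-- **Weighted layer sum with a RATIO-FORM loss.**  If the per-pair weights obey
`w_j ≤ g_j^{κ₀} + Λ·g_j^{κ₀−m}·g_n^m` (`Λ ≥ 0`, `m + 3 ≤ κ₀`, `κ₀ ≥ 6`) — the shape `g_j^{κ₀}(1 + Λ(g_n/g_j)^m)` by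
`ratio_term_eq` — then along a b-flow `Σ_{j=1}^{n} w_j ≤ (1+Λ)(2g_n⁴/((κ₀−m−2)b) + g_n⁶)·g_n^{κ₀−6}`. [cite: Balaban1988Convergent, (2.46) p.263] -/
theorem weightedSum_le_of_betaLower {b Λ : ℝ} (hb : 0 < b) (hΛ : 0 ≤ Λ)
    (hpos : ∀ j, j ≤ K → 0 < F.g j) (hrg : F.SatisfiesRG K)
    (hlb : ∀ j, j < K → b ≤ F.β (j + 1) (F.g j))
    {κ₀ m : ℕ} (hm : m + 3 ≤ κ₀) (h6 : 6 ≤ κ₀) {n : ℕ} (hnK : n ≤ K)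
    (w : ℕ → ℝ) (hw : ∀ j ∈ Finset.Icc 1 n, w j ≤ (F.g j) ^ κ₀ + Λ * ((F.g j) ^ (κ₀ - m) * (F.g n) ^ m)) :
    ∑ j ∈ Finset.Icc 1 n, w j ≤
      (1 + Λ) * ((2 * (F.g n) ^ 4 / (((κ₀ : ℝ) - m - 2) * b) + (F.g n) ^ 6) * (F.g n) ^ (κ₀ - 6)) := by
  have hn : 0 < F.g n := hpos n hnK
  -- unshifted part, m = 0
  have h0 := ratioSum_le_of_betaLower' F K hb hpos hrg hlb (m := 0) (by omega) h6 hnK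
  simp only [Nat.sub_zero, pow_zero, mul_one, Nat.cast_zero, sub_zero] at h0
  -- shifted part
  have h1 := ratioSum_le_of_betaLower' F K hb hpos hrg hlb hm h6 hnK
  have hsum := Finset.sum_le_sum hw
  rw [Finset.sum_add_distrib, ← Finset.mul_sum] at hsum
  -- compare the two currencies: κ₀ - 2 ≥ κ₀ - m - 2
  have hc : 0 < ((κ₀ : ℝ) - m - 2) * b := by
    have : ((m + 3 : ℕ) : ℝ) ≤ κ₀ := by exact_mod_cast hm
    push_cast at this
    exact mul_pos (by linarith) hb
  have hcur : 2 * (F.g n) ^ 4 / (((κ₀ : ℝ) - 2) * b) + (F.g n) ^ 6 ≤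
      2 * (F.g n) ^ 4 / (((κ₀ : ℝ) - m - 2) * b) + (F.g n) ^ 6 := by
    have : 2 * (F.g n) ^ 4 / (((κ₀ : ℝ) - 2) * b) ≤ 2 * (F.g n) ^ 4 / (((κ₀ : ℝ) - m - 2) * b) := by
      apply div_le_div_of_nonneg_left (by positivity) hc
      exact mul_le_mul_of_nonneg_right (by linarith [(Nat.cast_nonneg m : (0:ℝ) ≤ m)]) hb.le
    linarith
  set C := (2 * (F.g n) ^ 4 / (((κ₀ : ℝ) - m - 2) * b) + (F.g n) ^ 6) * (F.g n) ^ (κ₀ - 6) with hC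
  have hgpow : 0 ≤ (F.g n) ^ (κ₀ - 6) := pow_nonneg hn.le _
  have h0' : ∑ j ∈ Finset.Icc 1 n, (F.g j) ^ κ₀ ≤ C := by
    refine h0.trans ?_
    rw [hC]; exact mul_le_mul_of_nonneg_right hcur hgpow
  have h1' : Λ * ∑ j ∈ Finset.Icc 1 n, (F.g j) ^ (κ₀ - m) * (F.g n) ^ m ≤ Λ * C :=
    mul_le_mul_of_nonneg_left h1 hΛ
  calc ∑ j ∈ Finset.Icc 1 n, w j
      ≤ ∑ j ∈ Finset.Icc 1 n, (F.g j) ^ κ₀ + Λ * ∑ j ∈ Finset.Icc 1 n, (F.g j) ^ (κ₀ - m) * (F.g n) ^ m := hsum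
    _ ≤ C + Λ * C := add_le_add h0' h1'
    _ = (1 + Λ) * C := by ring

/-- **(2.46), middle member AS PRINTED, from a ratio-form weight**: under the hypotheses of
`weightedSum_le_of_betaLower`, the interval bound `g_n ≤ γ` and the pure γ-smallness
`(1+Λ)(2γ⁴/((κ₀−m−2)b) + γ⁶) < 1` ("g sufficiently small", now depending on `κ₀, m, b, Λ`):
`Σ_{j=1}^{n} w_j < g_n^{κ₀−6}`. [cite: Balaban1988Convergent, (2.46) p.263] -/
theorem sum246_of_ratioWeight {b Λ γ : ℝ} (hb : 0 < b) (hΛ : 0 ≤ Λ)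
    (hpos : ∀ j, j ≤ K → 0 < F.g j) (hrg : F.SatisfiesRG K)
    (hlb : ∀ j, j < K → b ≤ F.β (j + 1) (F.g j))
    {κ₀ m : ℕ} (hm : m + 3 ≤ κ₀) (h6 : 6 ≤ κ₀) {n : ℕ} (hnK : n ≤ K) (hnγ : F.g n ≤ γ)
    (hsmall : (1 + Λ) * (2 * γ ^ 4 / (((κ₀ : ℝ) - m - 2) * b) + γ ^ 6) < 1)
    (w : ℕ → ℝ) (hw : ∀ j ∈ Finset.Icc 1 n, w j ≤ (F.g j) ^ κ₀ + Λ * ((F.g j) ^ (κ₀ - m) * (F.g n) ^ m)) :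
    ∑ j ∈ Finset.Icc 1 n, w j < (F.g n) ^ (κ₀ - 6) := by
  have hn : 0 < F.g n := hpos n hnK
  have h := weightedSum_le_of_betaLower F K hb hΛ hpos hrg hlb hm h6 hnK w hw
  have hc : 0 < ((κ₀ : ℝ) - m - 2) * b := by
    have : ((m + 3 : ℕ) : ℝ) ≤ κ₀ := by exact_mod_cast hm
    push_cast at this
    exact mul_pos (by linarith) hb
  have hcur := currency_mono hn.le hnγ hc
  have hS : (1 + Λ) * (2 * (F.g n) ^ 4 / (((κ₀ : ℝ) - m - 2) * b) + (F.g n) ^ 6) < 1 :=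
    lt_of_le_of_lt (mul_le_mul_of_nonneg_left hcur (by linarith)) hsmall
  have hpow : 0 < (F.g n) ^ (κ₀ - 6) := pow_pos hn _
  calc ∑ j ∈ Finset.Icc 1 n, w j
      ≤ (1 + Λ) * ((2 * (F.g n) ^ 4 / (((κ₀ : ℝ) - m - 2) * b) + (F.g n) ^ 6) * (F.g n) ^ (κ₀ - 6)) := h
    _ = ((1 + Λ) * (2 * (F.g n) ^ 4 / (((κ₀ : ℝ) - m - 2) * b) + (F.g n) ^ 6)) * (F.g n) ^ (κ₀ - 6) := by
        ring
    _ < 1 * (F.g n) ^ (κ₀ - 6) := mul_lt_mul_of_pos_right hS hpow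
    _ = (F.g n) ^ (κ₀ - 6) := one_mul _

/-- **(2.46), middle and last members AS PRINTED (`κ₀ ≥ 7`), with the ratio-form loss `(g_n/g_j)⁴` of GAPS
G-adv3-31 booked into the first member** — in the shape of the (2.46) clause of `B14.Bounds245to249` /
`B14FlowStep.bounds246_of_betaPos`: from a first member `|𝐑_k| ≤ R₁ Σ_n |Γ_n| Σ_{j≤n} w_{n,j}` whose weights obey
`w_{n,j} ≤ g_j^{κ₀} + Λ·g_j^{κ₀−4}·g_n⁴` (the reconstructed Cauchy count, ratio form), nonnegative volumes, `R₁ ≥ 0`,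
(0.20), the interval hypothesis, `b ≤ β_{j+1}(g_j)` (`b > 0`), `κ₀ ≥ 7`, and the γ-smallness
`(1+Λ)(2γ⁴/((κ₀−6)b) + γ⁶) < 1`, `R₁γ^{κ₀−6} ≤ 1` (*"for κ₀ ≥ 7 and g sufficiently small"*; *"the constant R₁ can be
taken as equal to 1 for g_j sufficiently small"*): `|𝐑_k| ≤ R₁ Σ_n |Γ_n| g_n^{κ₀−6} ≤ Σ_n |Γ_n|`.  The printed
threshold `κ₀ ≥ 7` and the printed middle member survive; only the meaning of "g sufficiently small" acquires `Λ`. [cite: Balaban1988Convergent, (2.46) p.263] -/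
theorem bounds246_of_ratio4Weight {b Λ γ R₁ Rtot : ℝ} (hb : 0 < b) (hΛ : 0 ≤ Λ) (hR₁ : 0 ≤ R₁)
    (hrg : F.SatisfiesRG K) (hI : F.InInterval γ K)
    (hlb : ∀ j, j < K → b ≤ F.β (j + 1) (F.g j)) {κ₀ : ℕ} (hκ : 7 ≤ κ₀)
    (hsmall : (1 + Λ) * (2 * γ ^ 4 / (((κ₀ : ℝ) - 4 - 2) * b) + γ ^ 6) < 1)
    (hsmallR : R₁ * γ ^ (κ₀ - 6) ≤ 1)
    (gammaVol : ℕ → ℝ) (hvol : ∀ n, 0 ≤ gammaVol n) {k : ℕ} (hk : k ≤ K)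
    (w : ℕ → ℕ → ℝ)
    (hw : ∀ n, n ≤ K → ∀ j ∈ Finset.Icc 1 n, w n j ≤ (F.g j) ^ κ₀ + Λ * ((F.g j) ^ (κ₀ - 4) * (F.g n) ^ 4))
    (hfirst : |Rtot| ≤ R₁ * ∑ n ∈ Finset.Icc 1 k, gammaVol n * ∑ j ∈ Finset.Icc 1 n, w n j) :
    |Rtot| ≤ R₁ * ∑ n ∈ Finset.Icc 1 k, gammaVol n * (F.g n) ^ (κ₀ - 6) ∧
      R₁ * ∑ n ∈ Finset.Icc 1 k, gammaVol n * (F.g n) ^ (κ₀ - 6) ≤ ∑ n ∈ Finset.Icc 1 k, gammaVol n := by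
  have hpos : ∀ j, j ≤ K → 0 < F.g j := fun j hj => (hI j hj).1
  have hmid : ∀ n, n ≤ K → ∑ j ∈ Finset.Icc 1 n, w n j < (F.g n) ^ (κ₀ - 6) := fun n hnK =>
    sum246_of_ratioWeight F K hb hΛ hpos hrg hlb (m := 4) (by omega) (by omega) hnK (hI n hnK).2 hsmall
      (w n) (hw n hnK)
  refine ⟨?_, ?_⟩
  · refine le_trans hfirst (mul_le_mul_of_nonneg_left ?_ hR₁)
    apply Finset.sum_le_sum
    intro n hn
    have hnK : n ≤ K := le_trans (Finset.mem_Icc.mp hn).2 hk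
    exact mul_le_mul_of_nonneg_left (hmid n hnK).le (hvol n)
  · rw [Finset.mul_sum]
    apply Finset.sum_le_sum
    intro n hn
    have hnK : n ≤ K := le_trans (Finset.mem_Icc.mp hn).2 hk
    have hgn := hI n hnK
    have hγ6 : R₁ * (F.g n) ^ (κ₀ - 6) ≤ 1 :=
      le_trans (mul_le_mul_of_nonneg_left (pow_le_pow_left₀ hgn.1.le hgn.2 _) hR₁) hsmallR
    calc R₁ * (gammaVol n * (F.g n) ^ (κ₀ - 6)) = gammaVol n * (R₁ * (F.g n) ^ (κ₀ - 6)) := by ring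
      _ ≤ gammaVol n * 1 := mul_le_mul_of_nonneg_left hγ6 (hvol n)
      _ = gammaVol n := mul_one _

/-- Non-vacuity of the γ-smallness of `bounds246_of_ratio4Weight` at the printed threshold `κ₀ = 7`:
`b = 1/20`, `Λ = 1`, `γ = 1/10`, `R₁ = 1`. [folklore] -/
theorem ratio4_smallness_example :
    (1 + (1:ℝ)) * (2 * (1/10 : ℝ) ^ 4 / ((((7:ℕ) : ℝ) - 4 - 2) * (1/20)) + (1/10 : ℝ) ^ 6) < 1 ∧
      (1:ℝ) * (1/10 : ℝ) ^ (7 - 6) ≤ 1 := by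
  constructor <;> norm_num

/-- **The same from the DEFECTED running** (averaged / eventual asymptotic freedom, END-statement grade): weights
`w_j ≤ g_j^{κ₀} + Λ·g_j^{κ₀−m}·g_n^m`, (0.20), interval, `b(n−m′) − B ≤ Σ_{[m′,n)} β`, `Bγ² ≤ 1/2`, `m + 3 ≤ κ₀`,
`κ₀ ≥ 6` give `Σ_{j=1}^{n} w_j ≤ (1+Λ)(√2)^{κ₀−2}(2g_n⁴/((κ₀−m−2)b) + g_n⁶)·g_n^{κ₀−6}`, hence `< g_n^{κ₀−6}` under the
γ-smallness `(1+Λ)(√2)^{κ₀−2}(2γ⁴/((κ₀−m−2)b) + γ⁶) < 1`. [cite: Balaban1988Convergent, (2.46) p.263] -/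
theorem sum246_of_ratioWeight_avgAF {b B Λ γ : ℝ} (hb : 0 < b) (hΛ : 0 ≤ Λ)
    (hrg : F.SatisfiesRG K) (hI : F.InInterval γ K)
    (hav : ∀ m n, m ≤ n → n ≤ K → b * ((n : ℝ) - m) - B ≤ ∑ j ∈ Finset.Ico m n, F.β (j + 1) (F.g j))
    (hBγ : B * γ ^ 2 ≤ 1 / 2) {κ₀ m : ℕ} (hm : m + 3 ≤ κ₀) (h6 : 6 ≤ κ₀) {n : ℕ} (hnK : n ≤ K)
    (hsmall : (1 + Λ) * Real.sqrt 2 ^ (κ₀ - 2) * (2 * γ ^ 4 / (((κ₀ : ℝ) - m - 2) * b) + γ ^ 6) < 1)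
    (w : ℕ → ℝ) (hw : ∀ j ∈ Finset.Icc 1 n, w j ≤ (F.g j) ^ κ₀ + Λ * ((F.g j) ^ (κ₀ - m) * (F.g n) ^ m)) :
    ∑ j ∈ Finset.Icc 1 n, w j < (F.g n) ^ (κ₀ - 6) := by
  have hpos : ∀ j, j ≤ K → 0 < F.g j := fun j hj => (hI j hj).1
  have hn : 0 < F.g n := hpos n hnK
  have hnγ : F.g n ≤ γ := (hI n hnK).2
  have hs0 : 0 ≤ Real.sqrt 2 ^ (κ₀ - 2) := pow_nonneg (Real.sqrt_nonneg 2) _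
  have hc : 0 < ((κ₀ : ℝ) - m - 2) * b := by
    have : ((m + 3 : ℕ) : ℝ) ≤ κ₀ := by exact_mod_cast hm
    push_cast at this
    exact mul_pos (by linarith) hb
  have hc0 : 0 < ((κ₀ : ℝ) - 0 - 2) * b := by
    have : ((m + 3 : ℕ) : ℝ) ≤ κ₀ := by exact_mod_cast hm
    push_cast at this
    exact mul_pos (by linarith [(Nat.cast_nonneg m : (0:ℝ) ≤ m)]) hb
  -- unshifted part (m = 0) and shifted part
  have h0 := ratioSum_le_of_avgAF F K hb hrg hI hav hBγ (m := 0) (by omega) h6 hnK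
  simp only [Nat.sub_zero, pow_zero, mul_one, Nat.cast_zero] at h0
  have h1 := ratioSum_le_of_avgAF F K hb hrg hI hav hBγ hm h6 hnK
  have hsum := Finset.sum_le_sum hw
  rw [Finset.sum_add_distrib, ← Finset.mul_sum] at hsum
  set cur := 2 * (F.g n) ^ 4 / (((κ₀ : ℝ) - m - 2) * b) + (F.g n) ^ 6 with hcur_def
  have hcur0 : 2 * (F.g n) ^ 4 / (((κ₀ : ℝ) - 0 - 2) * b) + (F.g n) ^ 6 ≤ cur := by
    have : 2 * (F.g n) ^ 4 / (((κ₀ : ℝ) - 0 - 2) * b) ≤ 2 * (F.g n) ^ 4 / (((κ₀ : ℝ) - m - 2) * b) := by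
      apply div_le_div_of_nonneg_left (by positivity) hc
      exact mul_le_mul_of_nonneg_right (by linarith [(Nat.cast_nonneg m : (0:ℝ) ≤ m)]) hb.le
    rw [hcur_def]; linarith
  set C := Real.sqrt 2 ^ (κ₀ - 2) * (cur * (F.g n) ^ (κ₀ - 6)) with hC
  have hgpow : 0 ≤ (F.g n) ^ (κ₀ - 6) := pow_nonneg hn.le _
  have h0' : ∑ j ∈ Finset.Icc 1 n, (F.g j) ^ κ₀ ≤ C := by
    refine h0.trans ?_
    rw [hC]
    exact mul_le_mul_of_nonneg_left (mul_le_mul_of_nonneg_right hcur0 hgpow) hs0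
  have h1' : Λ * ∑ j ∈ Finset.Icc 1 n, (F.g j) ^ (κ₀ - m) * (F.g n) ^ m ≤ Λ * C :=
    mul_le_mul_of_nonneg_left h1 hΛ
  have hle : ∑ j ∈ Finset.Icc 1 n, w j ≤ (1 + Λ) * C := by
    calc ∑ j ∈ Finset.Icc 1 n, w j
        ≤ ∑ j ∈ Finset.Icc 1 n, (F.g j) ^ κ₀ + Λ * ∑ j ∈ Finset.Icc 1 n, (F.g j) ^ (κ₀ - m) * (F.g n) ^ m :=
          hsum
      _ ≤ C + Λ * C := add_le_add h0' h1'
      _ = (1 + Λ) * C := by ring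
  have hcurγ : cur ≤ 2 * γ ^ 4 / (((κ₀ : ℝ) - m - 2) * b) + γ ^ 6 := by
    rw [hcur_def]; exact currency_mono hn.le hnγ hc
  have hS : (1 + Λ) * Real.sqrt 2 ^ (κ₀ - 2) * cur < 1 :=
    lt_of_le_of_lt (mul_le_mul_of_nonneg_left hcurγ (by positivity)) hsmall
  have hpow : 0 < (F.g n) ^ (κ₀ - 6) := pow_pos hn _
  calc ∑ j ∈ Finset.Icc 1 n, w j ≤ (1 + Λ) * C := hle
    _ = ((1 + Λ) * Real.sqrt 2 ^ (κ₀ - 2) * cur) * (F.g n) ^ (κ₀ - 6) := by rw [hC]; ring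
    _ < 1 * (F.g n) ^ (κ₀ - 6) := mul_lt_mul_of_pos_right hS hpow
    _ = (F.g n) ^ (κ₀ - 6) := one_mul _

/-- The defected-running form specialised to EVENTUAL asymptotic freedom along the run (`β_{j+1}(g_j) ≥ b > 0` for
`k₀ ≤ j < K`, `≥ −β′` before; defect `B = (b+β′)k₀`, `B14FlowStep.avgAF_of_eventualLower`) with the ratio loss
`m = 4` and the printed `κ₀ ≥ 7`: `Σ_{j=1}^{n} w_j < g_n^{κ₀−6}`. [cite: Balaban1988Convergent, (2.46) p.263] -/
theorem sum246_of_ratio4Weight_eventual {b β' Λ γ : ℝ} {k₀ : ℕ} (hb : 0 < b) (hβ' : 0 ≤ β') (hΛ : 0 ≤ Λ)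
    (hrg : F.SatisfiesRG K) (hI : F.InInterval γ K)
    (hlo : ∀ j, j < K → -β' ≤ F.β (j + 1) (F.g j))
    (htail : ∀ j, k₀ ≤ j → j < K → b ≤ F.β (j + 1) (F.g j))
    (hBγ : (b + β') * k₀ * γ ^ 2 ≤ 1 / 2) {κ₀ : ℕ} (hκ : 7 ≤ κ₀) {n : ℕ} (hnK : n ≤ K)
    (hsmall : (1 + Λ) * Real.sqrt 2 ^ (κ₀ - 2) * (2 * γ ^ 4 / (((κ₀ : ℝ) - 4 - 2) * b) + γ ^ 6) < 1)
    (w : ℕ → ℝ) (hw : ∀ j ∈ Finset.Icc 1 n, w j ≤ (F.g j) ^ κ₀ + Λ * ((F.g j) ^ (κ₀ - 4) * (F.g n) ^ 4)) :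
    ∑ j ∈ Finset.Icc 1 n, w j < (F.g n) ^ (κ₀ - 6) := by
  have hav := B14FlowStep.avgAF_of_eventualLower F K hβ' hb.le hlo htail
  exact sum246_of_ratioWeight_avgAF F K hb hΛ hrg hI hav hBγ (m := 4) (by omega) (by omega) hnK
    (by exact_mod_cast hsmall) w hw

/-! ## E. The obstruction in the kernel: the flow gives the OPPOSITE of a lag-uniform ratio bound -/

/-- **Why the absorption must happen in the j-sum and not per domain** (GAPS G-adv3-31: *"it needs
sup_{j≤n≤k} g_n/g_j < ∞, which the flow hypotheses … do not give (they give the opposite …)"*, kernel form): along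
(0.20) with `b ≤ β_{j+1}(g_j)` and positive couplings, `(g_n/g_j)² ≥ 1 + b·g_n²·(n − j)` for `j ≤ n ≤ K` — at fixed
`g_n` the ratio grows without bound in the lag. [cite: Balaban1987RG1, (0.20) p.256] -/
theorem ratio_sq_ge_of_betaLower {b : ℝ}
    (hpos : ∀ j, j ≤ K → 0 < F.g j) (hrg : F.SatisfiesRG K)
    (hlb : ∀ j, j < K → b ≤ F.β (j + 1) (F.g j))
    {j n : ℕ} (hjn : j ≤ n) (hnK : n ≤ K) :
    1 + b * (F.g n) ^ 2 * ((n : ℝ) - j) ≤ (F.g n / F.g j) ^ 2 := by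
  have hj : 0 < F.g j := hpos j (hjn.trans hnK)
  have hn : 0 < F.g n := hpos n hnK
  have hrun := B14FlowStep.running_of_betaLower F K hrg hlb hjn hnK
  have hmul := mul_le_mul_of_nonneg_left hrun (pow_nonneg hn.le 2)
  have e1 : (F.g n) ^ 2 * (1 / (F.g n) ^ 2 + b * ((n : ℝ) - j)) = 1 + b * (F.g n) ^ 2 * ((n : ℝ) - j) := by
    field_simp
  have e2 : (F.g n) ^ 2 * (1 / (F.g j) ^ 2) = (F.g n / F.g j) ^ 2 := by
    rw [div_pow]; ring
  rw [e1, e2] at hmul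
  exact hmul

/-- The endpoint form: for a run of `K` steps ending at the renormalised coupling `g_K = g`, the UV-to-IR ratio obeys
`(g/g_0)² ≥ 1 + b·g²·K` — unbounded as the number of steps `K → ∞` (the continuum limit) at fixed `g`; so no
`K`-uniform bound on `g_n/g_j` is available to a same-`κ₀` per-domain estimate. [cite: Balaban1987RG1, (0.20) p.256] -/
theorem endpoint_ratio_sq_ge {b : ℝ}
    (hpos : ∀ j, j ≤ K → 0 < F.g j) (hrg : F.SatisfiesRG K)
    (hlb : ∀ j, j < K → b ≤ F.β (j + 1) (F.g j)) :
    1 + b * (F.g K) ^ 2 * (K : ℝ) ≤ (F.g K / F.g 0) ^ 2 := by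
  have := ratio_sq_ge_of_betaLower F K hpos hrg hlb (Nat.zero_le K) le_rfl
  simpa using this

/-- Quantitative unboundedness: along a b-flow (`b > 0`), for any `C`, every pair with lag
`n − j ≥ C/(b·g_n²)` has `(g_n/g_j)² ≥ 1 + C`. [folklore] -/
theorem ratio_sq_ge_of_lag {b C : ℝ} (hb : 0 < b)
    (hpos : ∀ j, j ≤ K → 0 < F.g j) (hrg : F.SatisfiesRG K)
    (hlb : ∀ j, j < K → b ≤ F.β (j + 1) (F.g j))
    {j n : ℕ} (hjn : j ≤ n) (hnK : n ≤ K) (hlag : C / (b * (F.g n) ^ 2) ≤ (n : ℝ) - j) :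
    1 + C ≤ (F.g n / F.g j) ^ 2 := by
  have hn : 0 < F.g n := hpos n hnK
  have h := ratio_sq_ge_of_betaLower F K hpos hrg hlb hjn hnK
  have hbg : 0 < b * (F.g n) ^ 2 := by positivity
  have : C ≤ b * (F.g n) ^ 2 * ((n : ℝ) - j) := by
    rw [div_le_iff₀ hbg] at hlag; linarith
  linarith

end AlongFlow

/-! ## F. The B14 instance of the ratio: `ε_n/α_{0,j}` (2.4)/(2.28) under the reconstructed (X12) `q₀ ≥ p₀` -/

/-- `1 ≤ log g⁻²` and `g_j ≤ g_n` give `(log g_n⁻²)^{p₀} ≤ (log g_j⁻²)^{q₀}` when `p₀ ≤ q₀`. [folklore] -/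
theorem logpow_le_of_exponents {gj gn : ℝ} {p₀ q₀ : ℕ} (hgj : 0 < gj) (hle : gj ≤ gn)
    (hx : 1 ≤ Real.log (gn ^ 2)⁻¹) (hpq : p₀ ≤ q₀) :
    (Real.log (gn ^ 2)⁻¹) ^ p₀ ≤ (Real.log (gj ^ 2)⁻¹) ^ q₀ := by
  have hmono : Real.log (gn ^ 2)⁻¹ ≤ Real.log (gj ^ 2)⁻¹ := B14FlowStep.log_inv_sq_mono hgj hle
  have hxj : 1 ≤ Real.log (gj ^ 2)⁻¹ := hx.trans hmono
  calc (Real.log (gn ^ 2)⁻¹) ^ p₀ ≤ (Real.log (gj ^ 2)⁻¹) ^ p₀ :=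
        pow_le_pow_left₀ (by linarith) hmono p₀
    _ ≤ (Real.log (gj ^ 2)⁻¹) ^ q₀ := pow_le_pow_right₀ hxj hpq

/-- **The Cauchy ratio of GAPS G-adv3-31 in flow currency.**  With `ε_n = g_n·p₀(g_n) = g_nA₀(log g_n^{−2})^{p₀}`
((2.4), `Setup.p0Profile A₀ p₀`) and `α_{0,j} = g_jC₀(log g_j^{−2})^{q₀}` ((2.28), the same profile with `C₀, q₀`):
for `0 < g_j ≤ g_n`, `log g_n^{−2} ≥ 1`, `A₀ ≥ 0`, `C₀ > 0` and `p₀ ≤ q₀`, `ε_n/α_{0,j} ≤ (A₀/C₀)·(g_n/g_j)`.  The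
exponent condition `q₀ ≥ p₀` is the cell's RECONSTRUCTION (X12) (`SMALLNESS.md` §4.1, `B14Radii.fits_of_exponents` /
`exponent_necessary`), NOT printed: (2.28) prints only *"q₀, q₁ are integers greater than 1"*. [cite: Balaban1988Convergent, (2.4) p.255 and (2.28) p.259] -/
theorem epsOverAlpha_le_ratio {A₀ C₀ gj gn : ℝ} {p₀ q₀ : ℕ} (hA₀ : 0 ≤ A₀) (hC₀ : 0 < C₀)
    (hgj : 0 < gj) (hle : gj ≤ gn) (hx : 1 ≤ Real.log (gn ^ 2)⁻¹) (hpq : p₀ ≤ q₀) :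
    (gn * p0Profile A₀ p₀ gn) / (gj * p0Profile C₀ q₀ gj) ≤ (A₀ / C₀) * (gn / gj) := by
  have hkey := logpow_le_of_exponents hgj hle hx hpq
  unfold p0Profile
  have hgn : 0 < gn := lt_of_lt_of_le hgj hle
  set xn := Real.log (gn ^ 2)⁻¹ with hxn
  set xj := Real.log (gj ^ 2)⁻¹ with hxj_def
  have hmono : xn ≤ xj := B14FlowStep.log_inv_sq_mono hgj hle
  have hxj : 1 ≤ xj := hx.trans hmono
  have hq : 0 < xj ^ q₀ := pow_pos (by linarith) q₀
  have hq' : xj ^ q₀ ≠ 0 := hq.ne'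
  have hden : 0 < gj * (C₀ * xj ^ q₀) := by positivity
  have hnum : gn * (A₀ * xn ^ p₀) ≤ gn * (A₀ * xj ^ q₀) :=
    mul_le_mul_of_nonneg_left (mul_le_mul_of_nonneg_left hkey hA₀) hgn.le
  calc gn * (A₀ * xn ^ p₀) / (gj * (C₀ * xj ^ q₀))
      ≤ gn * (A₀ * xj ^ q₀) / (gj * (C₀ * xj ^ q₀)) := div_le_div_of_nonneg_right hnum hden.le
    _ = (A₀ / C₀) * (gn / gj) := by
        field_simp

/-- Without (X12) (`p₀ > q₀` allowed) the ratio keeps a polylogarithm of the CURRENT coupling only: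
`ε_n/α_{0,j} ≤ (A₀/C₀)·(g_n/g_j)·(log g_n^{−2})^{p₀−q₀}` (ℕ-subtraction: `= 1` when `p₀ ≤ q₀`) — still a ratio-form
loss, with `Λ` a function of `g_n` alone. [cite: Balaban1988Convergent, (2.4) p.255 and (2.28) p.259] -/
theorem epsOverAlpha_le_ratio_logpow {A₀ C₀ gj gn : ℝ} {p₀ q₀ : ℕ} (hA₀ : 0 ≤ A₀) (hC₀ : 0 < C₀)
    (hgj : 0 < gj) (hle : gj ≤ gn) (hx : 1 ≤ Real.log (gn ^ 2)⁻¹) :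
    (gn * p0Profile A₀ p₀ gn) / (gj * p0Profile C₀ q₀ gj) ≤
      (A₀ / C₀) * (gn / gj) * (Real.log (gn ^ 2)⁻¹) ^ (p₀ - q₀) := by
  unfold p0Profile
  have hgn : 0 < gn := lt_of_lt_of_le hgj hle
  set xn := Real.log (gn ^ 2)⁻¹ with hxn
  set xj := Real.log (gj ^ 2)⁻¹ with hxj_def
  have hmono : xn ≤ xj := B14FlowStep.log_inv_sq_mono hgj hle
  have hxj : 1 ≤ xj := hx.trans hmono
  have hq : 0 < xj ^ q₀ := pow_pos (by linarith) q₀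
  have hq' : xj ^ q₀ ≠ 0 := hq.ne'
  have hden : 0 < gj * (C₀ * xj ^ q₀) := by positivity
  -- xn^{p₀} ≤ xj^{q₀} · xn^{p₀ - q₀}
  have hkey : xn ^ p₀ ≤ xj ^ q₀ * xn ^ (p₀ - q₀) := by
    rcases le_or_gt p₀ q₀ with hpq | hqp
    · rw [Nat.sub_eq_zero_of_le hpq, pow_zero, mul_one]
      exact logpow_le_of_exponents hgj hle hx hpq
    · have e : xn ^ p₀ = xn ^ q₀ * xn ^ (p₀ - q₀) := by rw [← pow_add]; congr 1; omega
      rw [e]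
      exact mul_le_mul_of_nonneg_right (pow_le_pow_left₀ (by linarith) hmono q₀)
        (pow_nonneg (by linarith) _)
  have hnum : gn * (A₀ * xn ^ p₀) ≤ gn * (A₀ * (xj ^ q₀ * xn ^ (p₀ - q₀))) :=
    mul_le_mul_of_nonneg_left (mul_le_mul_of_nonneg_left hkey hA₀) hgn.le
  calc gn * (A₀ * xn ^ p₀) / (gj * (C₀ * xj ^ q₀))
      ≤ gn * (A₀ * (xj ^ q₀ * xn ^ (p₀ - q₀))) / (gj * (C₀ * xj ^ q₀)) :=
        div_le_div_of_nonneg_right hnum hden.le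
    _ = (A₀ / C₀) * (gn / gj) * xn ^ (p₀ - q₀) := by
        field_simp

/-- The Cauchy count's finite sum of ratio powers is dominated by its top power: for `r ≥ 0`,
`Σ_{m=0}^{4} r^m ≤ 5·(1 + r⁴)`. [folklore] -/
theorem sum_ratio_powers_le {r : ℝ} (hr : 0 ≤ r) :
    ∑ m ∈ Finset.range 5, r ^ m ≤ 5 * (1 + r ^ 4) := by
  have hterm : ∀ m ∈ Finset.range 5, r ^ m ≤ 1 + r ^ 4 := by
    intro m hm
    have hm4 : m ≤ 4 := Nat.le_of_lt_succ (Finset.mem_range.mp hm)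
    rcases le_or_gt r 1 with hr1 | hr1
    · have : r ^ m ≤ 1 := pow_le_one₀ hr hr1
      have : 0 ≤ r ^ 4 := pow_nonneg hr 4
      linarith
    · have : r ^ m ≤ r ^ 4 := pow_le_pow_right₀ hr1.le hm4
      linarith
  calc ∑ m ∈ Finset.range 5, r ^ m ≤ ∑ _m ∈ Finset.range 5, (1 + r ^ 4) := Finset.sum_le_sum hterm
    _ = 5 * (1 + r ^ 4) := by simp [Finset.sum_const, Finset.card_range]; ring

/-- **From the reconstructed Cauchy count to the ratio-form weight.**  If a per-pair term is bounded by the count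
`T ≤ c·g_j^{κ₀}·Σ_{m=0}^{4} r^m` (`c ≥ 0`) with the ratio `0 ≤ r ≤ Λ₀·(g_n/g_j)` (`g_j > 0`, `κ₀ ≥ 4`), then
`T ≤ 5c·(g_j^{κ₀} + Λ₀⁴·g_j^{κ₀−4}·g_n⁴)` — the hypothesis shape of §D with `Λ = Λ₀⁴` after division by `5c`. [folklore] -/
theorem weight_of_cauchyCount {T c r Λ₀ gj gn : ℝ} {κ₀ : ℕ} (hc : 0 ≤ c) (hr : 0 ≤ r)
    (hgj : 0 < gj) (hκ : 4 ≤ κ₀)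
    (hT : T ≤ c * gj ^ κ₀ * ∑ m ∈ Finset.range 5, r ^ m) (hrΛ : r ≤ Λ₀ * (gn / gj)) :
    T ≤ 5 * c * (gj ^ κ₀ + Λ₀ ^ 4 * (gj ^ (κ₀ - 4) * gn ^ 4)) := by
  have h5 := sum_ratio_powers_le hr
  have hr4 : r ^ 4 ≤ (Λ₀ * (gn / gj)) ^ 4 := pow_le_pow_left₀ hr hrΛ 4
  have hratio : gj ^ κ₀ * (Λ₀ * (gn / gj)) ^ 4 = Λ₀ ^ 4 * (gj ^ (κ₀ - 4) * gn ^ 4) := by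
    rw [mul_pow, ← mul_assoc, mul_comm (gj ^ κ₀), mul_assoc, ratio_term_eq hgj.ne' hκ]
  have hg : 0 ≤ c * gj ^ κ₀ := by positivity
  calc T ≤ c * gj ^ κ₀ * ∑ m ∈ Finset.range 5, r ^ m := hT
    _ ≤ c * gj ^ κ₀ * (5 * (1 + r ^ 4)) := mul_le_mul_of_nonneg_left h5 hg
    _ ≤ c * gj ^ κ₀ * (5 * (1 + (Λ₀ * (gn / gj)) ^ 4)) := by
        apply mul_le_mul_of_nonneg_left _ hg
        linarith
    _ = 5 * c * (gj ^ κ₀ + gj ^ κ₀ * (Λ₀ * (gn / gj)) ^ 4) := by ring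
    _ = 5 * c * (gj ^ κ₀ + Λ₀ ^ 4 * (gj ^ (κ₀ - 4) * gn ^ 4)) := by rw [hratio]

end Literature.MathematicalPhysics.QuantumFieldTheory.Balaban1983to89.B14Sum246Ratio
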